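import Literature.Analysis.FluidPDE.Tao2016AveragedNS.SplitCascadeAsymHigh
import Literature.Analysis.FluidPDE.Tao2016AveragedNS.SplitCascadeRescaledWindowCert
import HarnessLib

/-!
# The split Prop. 6.5: reproduction of the asymmetry/clock profile at the new checkpoint

T. Tao, *Finite time blowup for an averaged three-dimensional Navier–Stokes equation*,
arXiv:1402.0290v3, §6.4 Prop. 6.5 (the induction on scales), §6.5 (6.94).
HONEST FRAMING: statements about the SPLIT cascade model system; nothing here proves the split
Prop. 6.5 and nothing here concerns the true Navier–Stokes equations.

The three profile clauses of `RescaledSplitConclusion` (`SplitCascadeRescaled.lean`) at a time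
`τ₁ ∈ [0, T]` of the bootstrap window, reduced to INEQUALITIES BETWEEN LEVELS: the previous/current
shells `0, 1` are bounded by the window level (`SplitCascadeRescaledWindowCert.lean`, N2), every
shell `k ≥ 2` by the uniform high-shell level (`SplitCascadeAsymHigh.lean`), and the dormant clocks
by the energy alone ((6.94): `|b̃_{1+m}(τ₁)| ≤ √(2Ẽ_{1+m}) ≤ √2K⁻¹⁵(1+ε₀)^{-5m}`, so
`β(m) = 2√2K⁻¹⁵(1+ε₀)^{-5m}` reproduces itself for `μ₁ ≥ ½`). What is left to the assembly is the
choice of `η` and the `n₀`-largeness making the levels `≤ η(m)μ₁`.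

## References

* T. Tao, arXiv:1402.0290v3, §6.4 Prop. 6.5, §6.5 (6.94). [`Tao2016AveragedNS`]
-/

noncomputable section

open Set MeasureTheory intervalIntegral

namespace Literature.Analysis.FluidPDE

namespace Tao2016AveragedNS

open TaoCascade

section ProfileRepro

variable {γ ε₀ K ε C₁ C₂ C₃ : ℝ} {n₀ N : ℤ} {ηp : ℤ → ℝ} {βp : ℕ → ℝ} {τ : ℤ → ℝ}
  {Y : Fin 4 → ℤ → ℝ → ℝ} {W : Fin 3 → ℤ → ℝ → ℝ} {F : ℤ → ℝ → ℝ}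

/-- **Dormant clocks from the energy** ((6.94)): if `GoodAt` holds at `t`, then for `m ≥ 1`,
`|b̃_{1+m}(t)| ≤ √2·K⁻¹⁵·(1+ε₀)^{-5m}`. [cite: Tao2016AveragedNS, §6.5 (6.94)] -/
theorem RescaledSplitHypotheses.abs_b_dormant_le
    (h : RescaledSplitHypotheses γ ε₀ K ε C₁ C₂ C₃ n₀ N ηp βp τ Y W F) (hε₀ : 0 < ε₀) (hK : 0 < K)
    {t : ℝ} (ht : τ (n₀ - N) ≤ t) (hg : GoodAt ε₀ K Y F t) (m : ℕ) (hm : 1 ≤ m) :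
    |Y 1 (1 + m) t| ≤ Real.sqrt 2 * (K ^ 15)⁻¹ * (1 + ε₀) ^ (-(5 : ℝ) * m) := by
  have h0 : (0 : ℝ) < 1 + ε₀ := by linarith
  have ha := hg.after m hm
  have hsq := h.abs_le_sqrt_energy 1 (1 + m) ht
  refine hsq.trans ?_
  have hpow : (1 + ε₀) ^ (-(10 : ℝ) * m) = ((1 + ε₀) ^ (-(5 : ℝ) * m)) ^ 2 := by
    rw [← Real.rpow_natCast, ← Real.rpow_mul h0.le]; congr 1; push_cast; ring
  have hK2 : (K ^ 30)⁻¹ = ((K ^ 15)⁻¹) ^ 2 := by ring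
  calc Real.sqrt (2 * F (1 + m) t) ≤ Real.sqrt (2 * ((K ^ 30)⁻¹ * (1 + ε₀) ^ (-(10 : ℝ) * m))) :=
        Real.sqrt_le_sqrt (by linarith)
    _ = Real.sqrt 2 * (K ^ 15)⁻¹ * (1 + ε₀) ^ (-(5 : ℝ) * m) := by
        rw [Real.sqrt_mul (by norm_num), hpow, hK2, ← mul_pow, Real.sqrt_sq (by positivity)]
        ring

/-- **Profile reproduction at `τ₁`, reduced to level inequalities.** With `GoodAt` on `[0, T]`
(`T ≤ 100`), the profile `|Z̃_{i,k}(0)| ≤ η_m` (`k ∈ {-1,0,1}`), `τ₁ ∈ [0, T]` and a scale `μ₁`: if the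
new profile `η'`, `β'` dominates the window level (shells `0, 1`), the high-shell level (shells
`≥ 2`) and the energy clock level (scaled by `μ₁`), then the three profile clauses of
`RescaledSplitConclusion` hold at `τ₁`. [cite: Tao2016AveragedNS, §6.4 Prop. 6.5] -/
theorem RescaledSplitHypotheses.profile_repro
    (h : RescaledSplitHypotheses γ ε₀ K ε C₁ C₂ C₃ n₀ N ηp βp τ Y W F) (hε₀ : 0 < ε₀) (hε₀1 : ε₀ < 1)
    (hK : 1 ≤ K) (hε : 0 < ε) (hC₁ : 0 ≤ C₁) (hC₃ : 0 ≤ C₃) (hN : n₀ ≤ N) {T : ℝ} (hT : T ≤ 100)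
    (hgood : ∀ t ∈ Icc 0 T, GoodAt ε₀ K Y F t) {ηm : ℝ}
    (hη : ∀ i : Fin 3, |W i (-1) 0| ≤ ηm ∧ |W i 0 0| ≤ ηm ∧ |W i 1 0| ≤ ηm)
    {τ₁ μ₁ : ℝ} (hτ₁ : τ₁ ∈ Icc 0 T) {η' : ℤ → ℝ} {β' : ℕ → ℝ}
    (hη'prev : windowLevel ε₀ K ε C₁ n₀ ηm ≤ η' (-1) * μ₁)
    (hη'zero : windowLevel ε₀ K ε C₁ n₀ ηm ≤ η' 0 * μ₁)
    (hη'hi : ∀ m : ℕ, 1 ≤ m →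
      Real.exp ((ε + ε ^ 2 + 2 * (ε ^ 2)⁻¹ + ε⁻¹ * K ^ 10 + 6 * K) * Real.sqrt 2 * (K ^ 15)⁻¹ *
          (C₃ * geomConst ε₀ ((248 : ℝ) / 100) + 100)) *
        (Real.sqrt 3 * C₁ * (1 + ε₀) ^ (-(n₀ : ℝ) / 2) * (K ^ 15)⁻¹ *
          (C₃ * geomConst ε₀ ((248 : ℝ) / 100) + 100)) ≤ η' m * μ₁)
    (hβ' : ∀ m : ℕ, 1 ≤ m → Real.sqrt 2 * (K ^ 15)⁻¹ * (1 + ε₀) ^ (-(5 : ℝ) * m) ≤ β' m * μ₁) :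
    (∀ (i : Fin 3) (m : ℕ), |W i (1 + m) τ₁| ≤ η' m * μ₁) ∧
    (∀ i : Fin 3, |W i 0 τ₁| ≤ η' (-1) * μ₁) ∧
    (∀ m : ℕ, 1 ≤ m → -(β' m * μ₁) ≤ Y 1 (1 + m) τ₁) := by
  have hK0 : 0 < K := by linarith
  have hτ0 : τ (n₀ - N) ≤ 0 := h.tau_init_le hN
  have hτ₁' : τ (n₀ - N) ≤ τ₁ := hτ0.trans hτ₁.1
  refine ⟨fun i m => ?_, fun i => ?_, fun m hm => ?_⟩
  · rcases Nat.eq_zero_or_pos m with rfl | hm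
    · -- shell `1`: the window level
      have hw := h.absW_le_windowLevel hε₀ hε₀1 hε hK hC₁ hτ0 hT hgood hη hτ₁ i (Or.inr (Or.inr rfl))
      simp only [Nat.cast_zero, add_zero]
      exact hw.trans (by exact_mod_cast hη'zero)
    · -- shells `≥ 2`: the high-shell level
      have hk : (2 : ℤ) ≤ 1 + (m : ℤ) := by omega
      have hhi := h.asym_high_le hε₀ hε₀1 hK hε hC₁ hC₃ hN hT hgood hk hτ₁
      have hcomp : |W i (1 + m) τ₁| ≤ Real.sqrt (∑ j, W j (1 + (m : ℤ)) τ₁ ^ 2) := by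
        rw [← Real.sqrt_sq_eq_abs]
        apply Real.sqrt_le_sqrt
        rw [Fin.sum_univ_three]
        fin_cases i <;> simp <;> nlinarith [sq_nonneg (W 0 (1 + (m:ℤ)) τ₁), sq_nonneg (W 1 (1 + (m:ℤ)) τ₁),
          sq_nonneg (W 2 (1 + (m:ℤ)) τ₁)]
      exact hcomp.trans (hhi.trans (hη'hi m hm))
  · have hw := h.absW_le_windowLevel hε₀ hε₀1 hε hK hC₁ hτ0 hT hgood hη hτ₁ i (Or.inr (Or.inl rfl))
    exact hw.trans hη'prev
  · have hb := h.abs_b_dormant_le hε₀ hK0 hτ₁' (hgood τ₁ hτ₁) m hm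
    have := (abs_le.mp (hb.trans (hβ' m hm))).1
    linarith

end ProfileRepro

end Tao2016AveragedNS

end Literature.Analysis.FluidPDE
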